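import Mathlib.Data.Int.Basic
import Mathlib.Data.List.Basic

/-!
# Charted zero-excess layered-lattice Liouville — ZZZYRCVK: the KERNEL PROGRAM of the box-aware king remainder table (middle class)

Cell `decomp-a2c`, lens 2, generation 99.  Companion of «ZZZYRCV» (`schemeDominatedOnP_king_table`: domination from a table `T` with
`Σ_{v ∈ M} kcnt v δ · kcoef F v ≤ T δ`).  This file is the COMPUTABLE program whose kernel evaluation (`decide +kernel`, one K-file per slab of
columns, `set_option maxHeartbeats 0`) produces the integer table; its SOUNDNESS («ZZZYRCVL/M/N», `xiSlab_sound`: `xiSlab … = some B ⇒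
Σ_{v ∈ S} kcnt v δ · ⌈K·n(v)/F(v)⁴⌉ ≤ B[code3 δ]` for every finite set `S` of members in the slab; `xiSlab_sound_real`: `… ≤ B[code3 δ]/K` with the
exact kernel `n/F⁴`) is typed separately so that the slab K-files can be generated at once.  Edition 2: the offsets `xiQ0 / xiQmn / xiQmx` and the
row update `xiRowBins` are NAMED (the soundness proof unfolds `xiRowC = if cert then some (xiRowBins …) else none`); numbers unchanged.

MODEL (tree index coordinates `v = (Δγ₀, Δγ₁, Δm)`, RCP king paths: coordinate `j` moves `sign v_j` while `i < |v_j|`):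
* registry floor / ceiling of `9|ideal e_v|²`: `F = qmn + 6Δm²`, `Fmax = qmx + 6Δm²` with `qmn/qmx = min/max_{|d| ≤ 2} qhex(3Δγ₀+d, 3Δγ₁+d)`
  (`d` = registry-letter difference of the two layers; `d = 0` when `Δm = 0`);
* MEMBER `v`: `Fmax > HI1 ∧ F ≤ HI2` (`HI1 = 9·24² = 5184`: ideal-far; `HI2 = ⌈9·64²/λ_min²⌉`: actual length `≤ 64`);
* per member the coefficient `c = ⌈K·n(v)/F⁴⌉` (`K = 45927·2^60`, `n = max |v_j|`) times the KING RUN COUNTS, in closed form per row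
  `(Δγ₀, Δγ₁) = (x, y)` with in-plane thresholds `p = min(|x|,|y|) ≤ q = max(|x|,|y|)` and `m = |Δm|`:
  `m ≤ p`: all-three-move `m`, both-in-plane `p − m`, larger-in-plane `q − p`; `p ≤ m ≤ q`: `p`, larger-with-vertical `m − p`, larger `q − m`;
  `m ≥ q`: `p`, larger-with-vertical `q − p`, vertical-only `m − q` (`xiRowSums`, structural recursion on the member index); the mirror `−m` has the same counts with the vertical
  sign flipped, so `±m` share one division and each ROW adds into ≤ 10 step-code bins (`xiRowC`);
* the vertical member range of a row is supplied as a CERTIFICATE `(mA, mB)` (least `m ≥ 1` with `qmx + 6m² > HI1`, largest with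
  `qmn + 6m² ≤ HI2`) and CHECKED by four inequalities (`none` on failure) — no square roots in the kernel;
* bins are indexed by the step code `xiDcode δ = (δ₀+1)·9 + (δ₁+1)·3 + (δ₂+1)`; a slab = columns `x = xLo + i` over all rows `y = yLo + j`.
Reference semantics and the claimed table: desk/rcv_tab.py, rcv_rows3.py (bins equal to the last digit on columns 0,1,3,17,40,77,78;
`#eval` of this program = python on columns 3 and 40); measured kernel cost 0.98 ms per `|m|`-iteration (column 40: 7.3 s), whole table
≈ 862 k iterations ≈ 850 s ⇒ 4–5 K-files.  `max_δ Ξ(δ)/2^60 = 3.042e-4` (vertical step), N-column `(1+α⁻¹)·λ⁻⁸·3.04e-4 ≈ 1.07e-3` at `λ = 0.98`.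

Definition file (12 defs, computable, structurally recursive, 0 theorems); imports Mathlib only; no instance / notation / option; 0 sorry. [g99]
-/

namespace Summit.AtomisticToContinuum.Crystallization.Theorems.ChartedZeroExcessLayeredLatticeLiouville

/-- `a² + ab + b²`. -/
def xiQhex (a b : ℤ) : ℤ := a * a + a * b + b * b

/-- step code `(δ₀+1)·9 + (δ₁+1)·3 + (δ₂+1) ∈ [0, 26]` of the king step `(δ₀, δ₁, δ₂)`. -/
def xiDcode (d0 d1 d2 : ℤ) : ℕ := ((d0 + 1) * 9 + (d1 + 1) * 3 + (d2 + 1)).toNat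

/-- add `c` to entry `k` of a list of naturals. -/
def xiAddAt : List ℕ → ℕ → ℕ → List ℕ
  | [], _, _ => []
  | b :: bs, 0, c => (b + c) :: bs
  | b :: bs, k + 1, c => b :: xiAddAt bs k c

/-- ★ ROW SUMS over the members `m = mA + j` (`j < len`) of the row with in-plane thresholds `p ≤ q` (`= min/max(|x|,|y|)`):
`F = qmn + 6m²`, `c = ⌈K·max(q,m)/F⁴⌉`; returns `(S3, S2, S2', S1, Sm)` = the `c`-weighted king-run counts of the three regions
(`m ≤ p`: runs all-three `m`, both-in-plane `p−m`, larger-in-plane `q−p`; `p ≤ m ≤ q`: `p`, larger-with-vertical `m−p`, larger `q−m`;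
`m ≥ q`: `p`, larger-with-vertical `q−p`, vertical `m−q`).  Structural recursion on `len` (kernel-reducible, induction-friendly). -/
def xiRowSums (K qmn p q mA : ℕ) : ℕ → ℕ × ℕ × ℕ × ℕ × ℕ
  | 0 => (0, 0, 0, 0, 0)
  | len + 1 =>
    let s := xiRowSums K qmn p q mA len
    let m := mA + len
    let F := qmn + 6 * m * m
    let c := (K * max q m + F ^ 4 - 1) / F ^ 4
    if m ≤ p then (s.1 + m * c, s.2.1 + (p - m) * c, s.2.2.1, s.2.2.2.1 + (q - p) * c, s.2.2.2.2)
    else if m ≤ q then (s.1 + p * c, s.2.1, s.2.2.1 + (m - p) * c, s.2.2.2.1 + (q - m) * c, s.2.2.2.2)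
    else (s.1 + p * c, s.2.1, s.2.2.1 + (q - p) * c, s.2.2.2.1, s.2.2.2.2 + (m - q) * c)

/-- `9|ideal in-plane part|²` of the in-plane index difference `(x, y)` at registry-letter difference `0`. -/
def xiQ0 (x y : ℤ) : ℕ := (xiQhex (3 * x) (3 * y)).toNat

/-- registry FLOOR of `9|ideal in-plane part|²`: the minimum over the letter differences `|d| ≤ 2`. -/
def xiQmn (x y : ℤ) : ℕ :=
  min (min (min (xiQhex (3 * x) (3 * y)).toNat (xiQhex (3 * x + 1) (3 * y + 1)).toNat)
    (min (xiQhex (3 * x - 1) (3 * y - 1)).toNat (xiQhex (3 * x + 2) (3 * y + 2)).toNat)) (xiQhex (3 * x - 2) (3 * y - 2)).toNat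

/-- registry CEILING of `9|ideal in-plane part|²`: the maximum over the letter differences `|d| ≤ 2`. -/
def xiQmx (x y : ℤ) : ℕ :=
  max (max (max (xiQhex (3 * x) (3 * y)).toNat (xiQhex (3 * x + 1) (3 * y + 1)).toNat)
    (max (xiQhex (3 * x - 1) (3 * y - 1)).toNat (xiQhex (3 * x + 2) (3 * y + 2)).toNat)) (xiQhex (3 * x - 2) (3 * y - 2)).toNat

/-- ★ THE BIN UPDATE OF ONE ROW `(x, y)` with certified vertical member range `mA ≤ |m| ≤ mB`: the `m = 0` member (present iff
`HI1 < q0 ≤ HI2` and `(x, y) ≠ 0`; steps both-in-plane `p`, larger-alone `q − p`) and the row sums of `±m`, `m ∈ [mA, mB]`, distributed to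
the step codes (`≤ 10` adds). -/
def xiRowBins (K HI1 HI2 : ℕ) (x y : ℤ) (mA mB : ℕ) (bins : List ℕ) : List ℕ :=
  let ax := x.natAbs
  let ay := y.natAbs
  let sx := Int.sign x
  let sy := Int.sign y
  let p := min ax ay
  let q := max ax ay
  let c1 := if ay ≤ ax then xiDcode sx 0 0 else xiDcode 0 sy 0
  let c2u := if ay ≤ ax then xiDcode sx 0 1 else xiDcode 0 sy 1
  let c2d := if ay ≤ ax then xiDcode sx 0 (-1) else xiDcode 0 sy (-1)
  let bins0 := if HI1 < xiQ0 x y ∧ xiQ0 x y ≤ HI2 ∧ ¬(x = 0 ∧ y = 0) then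
      xiAddAt (xiAddAt bins (xiDcode sx sy 0) (p * ((K * q + xiQ0 x y ^ 4 - 1) / xiQ0 x y ^ 4))) c1
        ((q - p) * ((K * q + xiQ0 x y ^ 4 - 1) / xiQ0 x y ^ 4)) else bins
  let s := xiRowSums K (xiQmn x y) p q mA (mB + 1 - mA)
  xiAddAt (xiAddAt (xiAddAt (xiAddAt (xiAddAt (xiAddAt (xiAddAt (xiAddAt bins0
    (xiDcode sx sy 1) s.1) (xiDcode sx sy (-1)) s.1) (xiDcode sx sy 0) (2 * s.2.1)) c1 (2 * s.2.2.2.1)) c2u s.2.2.1) c2d s.2.2.1)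
    (xiDcode 0 0 1) s.2.2.2.2) (xiDcode 0 0 (-1)) s.2.2.2.2

/-- ★ ONE ROW `(x, y)`: CHECK the certificate `(mA, mB)` (least `mA ≥ 1` with `qmx + 6mA² > HI1`, largest `mB` with `qmn + 6mB² ≤ HI2`; four
inequalities, no square roots) and update the bins; `none` on a bad certificate. -/
def xiRowC (K HI1 HI2 : ℕ) (x y : ℤ) (mA mB : ℕ) (bins : List ℕ) : Option (List ℕ) :=
  if 1 ≤ mA ∧ HI1 < xiQmx x y + 6 * mA * mA ∧ (mA = 1 ∨ xiQmx x y + 6 * (mA - 1) * (mA - 1) ≤ HI1) ∧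
      HI2 < xiQmn x y + 6 * (mB + 1) * (mB + 1) ∧ (mB = 0 ∨ xiQmn x y + 6 * mB * mB ≤ HI2) then
    some (xiRowBins K HI1 HI2 x y mA mB bins)
  else none

/-- the rows `y, y+1, …` of column `x` with their certificates `(mA, mB)`, threaded through the bins (`none` = a bad certificate). -/
def xiColC (K HI1 HI2 : ℕ) (x : ℤ) : ℤ → List (ℕ × ℕ) → List ℕ → Option (List ℕ)
  | _, [], bins => some bins
  | y, c :: cs, bins =>
    match xiRowC K HI1 HI2 x y c.1 c.2 bins with
    | none => none
    | some bs => xiColC K HI1 HI2 x (y + 1) cs bs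

/-- the columns `x, x+1, …` (rows from `yLo`) with their row certificates, threaded through the bins. -/
def xiSlabC (K HI1 HI2 : ℕ) (yLo : ℤ) : ℤ → List (List (ℕ × ℕ)) → List ℕ → Option (List ℕ)
  | _, [], bins => some bins
  | x, cert :: rest, bins =>
    match xiColC K HI1 HI2 x yLo cert bins with
    | none => none
    | some bs => xiSlabC K HI1 HI2 yLo (x + 1) rest bs

/-- ★ THE SLAB: columns `xLo + i` (`i < certs.length`), rows `yLo + j`, starting from 27 empty bins. -/
def xiSlab (K HI1 HI2 : ℕ) (xLo yLo : ℤ) (certs : List (List (ℕ × ℕ))) : Option (List ℕ) :=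
  xiSlabC K HI1 HI2 yLo xLo certs (List.replicate 27 0)

end Summit.AtomisticToContinuum.Crystallization.Theorems.ChartedZeroExcessLayeredLatticeLiouville
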